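import Literature.Topology.FourManifolds.TubularSplitting
import Literature.Topology.FourManifolds.GluingConstruction
import Literature.Topology.FourManifolds.BoundaryGluingData
import Literature.Geometry.Manifold.SmoothEmbeddingCodRestrict
import HarnessLib

/-!
# The fibre sum of two manifolds along a framed submanifold exists (tube coordinates)

Topic `Literature/Topology/FourManifolds` (fact seat of the Seiberg–Witten leaf
`Literature.Barriers.SmoothPoincare4.akhmedovPark2010_lemma8_invariants`, A. Akhmedov,
B. D. Park, Invent. Math. 181 (2010), §9 Lemma 8: `X₁(m) = Y₁(1,1) #_ψ Z''(1,m)` is the *normal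
connected sum* = generalised fibre sum of two closed `4`-manifolds along genus-two surfaces of
self-intersection `0`).  R. Gompf, *A new construction of symplectic manifolds*, Ann. of Math. 142
(1995), §1: for closed manifolds `Y₁`, `Y₂` and embeddings `F ↪ Yᵢ` of a closed manifold with
trivial(ised) normal bundles `νᵢ ≅ F × ℝᶜ`, the fibre sum `Y₁ #_F Y₂` is obtained from
`(Y₁ ∖ F) ⊔ (Y₂ ∖ F)` by identifying the punctured tubular neighbourhoods `F × (B ∖ 0)` through the
orientation-reversing diffeomorphism `r ↦ 1 - r` of the radial coordinate; equivalently it is the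
union of the two tube complements `Yᵢ ∖ ν°ᵢ` glued along their boundaries `F × Sᶜ⁻¹`.

This file CONSTRUCTS the fibre sum in the smooth category, in the tube coordinates of
`TubularSplitting.lean` (a *tube* is a smooth open embedding `T : F × ℝᶜ → Y`; a *tube function*
`g` presents the tube piece `{g ≤ ¼} = T(F × B̄(0, ½))` and its complement `{¼ ≤ g}` as the
regular sublevel and superlevel sets of `RegularLevelSplitting.lean`), and proves that it is a
gluing of the two tube complements along their boundaries in the sense of the tree's
`BoundaryGluingData`
(`BoundaryGluingData.lean`) — exactly the datum `(X m, ψ m, G m)` consumed by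
`Literature.Barriers.SmoothPoincare4.akhmedovPark2010_lemma8_invariants_of_blocks_vanKampen`
(`SmallExoticaFrontierReductionLemma8BlocksProofs.lean`, §13) and by the signature / Euler
characteristic / orientability / van Kampen theorems for fibre sums
(`SignatureCupTrivialPieces.lean`, `OrientableBoundaryGluing.lean`, `BoundaryGluingVanKampen.lean`),
all of which take the glued manifold as a hypothesis.  Everything is PROVED; there is no
definition and no named fact (the maps of the construction are bare expressions inside the
statements and proofs):

* §1 the **radial flip** `v ↦ ((1 - ‖v‖)/‖v‖) v` of `ℝᶜ ∖ 0`: it has norm `1 - ‖v‖` on the unit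
  ball, is an involution of the punctured unit ball fixing the sphere of radius `½`, and is
  `C^∞` off `0`;
* §2 the **transition map** `Y ⊇ T(F × (B ∖ 0)) → Y'`, `T(f, v) ↦ T'(f, flip v)` of two tubes of
  the same `F`: its formula, its smoothness (`contMDiffOn_invFun_range`, the smooth inverse of a
  smooth embedding, `SmoothEmbeddingInverse.lean`), and its corestriction to the open piece
  `Y' ∖ T'(F × 0)`;
* §3 `exists_smoothGlueData_tubes` — **the open gluing datum**: the two open pieces
  `Aᵢ = Yᵢ ∖ Tᵢ(F × 0)` glue along the transition map into a `SmoothGlueData`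
  (`GluingConstruction.lean`) whose glued space is Hausdorff (the graph of the gluing map is the
  trace of the compact set `{(T₁(f, t u), T₂(f, (1 - t) u))}`, `f ∈ F`, `u ∈ Sᶜ⁻¹`, `t ∈ [0, 1]`,
  whose extra points `t = 0, 1` lie on the removed cores), compact (covered by the images of the
  compact sets `Yᵢ ∖ Tᵢ(F × B(0, ½))`) and second countable;
* §4 `exists_fibreSum_boundaryGluingData` — **the fibre sum exists as a boundary gluing of the
  two tube complements**: for tube functions `g₁`, `g₂` of the two tubes there are a closed smooth
  manifold `X` (the glued space of §3), a bijection `ψ : ∂{¼ ≤ g₁} ≃ ∂{¼ ≤ g₂}` with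
  `ψ(T₁(f, v)) = T₂(f, v)` (`‖v‖ = ½`; the flip is the identity on the sphere of radius `½`) and
  `G : BoundaryGluingData (boundaryData _) (boundaryData _) ψ X` with `jA = inl ∘ incl`,
  `jB = inr ∘ incl`: the complements `{¼ ≤ gᵢ} = Yᵢ ∖ Tᵢ(F × B(0, ½))` cover `X` and meet exactly
  along `T₁(F × S(0, ½)) ≡ T₂(F × S(0, ½))`;
* §5 `exists_fibreSum` — the same from the two smooth tubes alone (tube functions exist,
  `exists_tube_function`).

## References

* R. E. Gompf, *A new construction of symplectic manifolds*, Ann. of Math. 142 (1995) 527–595,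
  §1 (the fibre sum / symplectic sum along codimension-2 submanifolds with trivial normal
  bundle). [Gompf1995]
* R. E. Gompf, A. I. Stipsicz, *4-Manifolds and Kirby Calculus*, AMS 1999, §7.1 (fibre sums) and
  §8.3. [GompfStipsiczGSM1999]
* A. Kosinski, *Differential Manifolds* (1993), VI.1 (gluing manifolds along open subsets;
  Hausdorffness criterion). [Kosinski1993]
* A. Akhmedov, B. D. Park, Invent. Math. 181 (2010) 577–603, §9 ("the normal connected sum
  `X₁(m) = Y₁(1,1) #_ψ Z''(1,m)`"). [AkhmedovPark2010]
-/

noncomputable section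

open scoped Manifold ContDiff Topology
open Set Function Metric

namespace Literature.Topology.FourManifolds

/- Throughout, the *radial flip* of a punctured Euclidean space is the bare expression
`((1 - ‖v‖) * ‖v‖⁻¹) • v` (written `ρ v` in the docstrings; no notation, no definition). -/

/-! ### §1 The radial flip of the punctured unit ball -/

section Flip

variable {c : ℕ}

/-- `ρ v = (1 - ‖v‖) • (v/‖v‖)`. [folklore] -/
theorem radialFlip_eq_smul_smul (v : EuclideanSpace ℝ (Fin c)) :
    (((1 - ‖v‖) * ‖v‖⁻¹) • v) = (1 - ‖v‖) • (‖v‖⁻¹ • v) :=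
  mul_smul _ _ _

/-- On the closed unit ball minus the origin the radial flip has norm `‖ρ v‖ = 1 - ‖v‖`.
[folklore] -/
theorem norm_radialFlip {v : EuclideanSpace ℝ (Fin c)} (hv : v ≠ 0) (h1 : ‖v‖ ≤ 1) :
    ‖(((1 - ‖v‖) * ‖v‖⁻¹) • v)‖ = 1 - ‖v‖ := by
  rw [norm_smul, norm_mul, norm_inv, norm_norm, Real.norm_of_nonneg (sub_nonneg.2 h1),
    inv_mul_cancel_right₀ (norm_ne_zero_iff.2 hv)]

/-- On the punctured open unit ball the radial flip does not vanish. [folklore] -/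
theorem radialFlip_ne_zero {v : EuclideanSpace ℝ (Fin c)} (hv : v ≠ 0) (h1 : ‖v‖ < 1) :
    (((1 - ‖v‖) * ‖v‖⁻¹) • v) ≠ 0 := by
  rw [← norm_pos_iff, norm_radialFlip hv h1.le]
  exact sub_pos.2 h1

/-- On the punctured open unit ball the radial flip has norm `< 1`. [folklore] -/
theorem norm_radialFlip_lt_one {v : EuclideanSpace ℝ (Fin c)} (hv : v ≠ 0) (h1 : ‖v‖ ≤ 1) :
    ‖(((1 - ‖v‖) * ‖v‖⁻¹) • v)‖ < 1 := by
  rw [norm_radialFlip hv h1]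
  exact sub_lt_self _ (norm_pos_iff.2 hv)

/-- **The radial flip is an involution of the punctured open unit ball.** [folklore] -/
theorem radialFlip_radialFlip {v : EuclideanSpace ℝ (Fin c)} (hv : v ≠ 0) (h1 : ‖v‖ < 1) :
    (((1 - ‖(((1 - ‖v‖) * ‖v‖⁻¹) • v)‖) * ‖(((1 - ‖v‖) * ‖v‖⁻¹) • v)‖⁻¹) •
      (((1 - ‖v‖) * ‖v‖⁻¹) • v)) = v := by
  have h0 : ‖v‖ ≠ 0 := norm_ne_zero_iff.2 hv
  have h1' : 1 - ‖v‖ ≠ 0 := (sub_pos.2 h1).ne'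
  rw [norm_radialFlip hv h1.le, smul_smul, sub_sub_cancel,
    show ‖v‖ * (1 - ‖v‖)⁻¹ * ((1 - ‖v‖) * ‖v‖⁻¹) = 1 by field_simp, one_smul]

/-- The radial flip is the identity on the sphere of radius `½`. [folklore] -/
theorem radialFlip_of_norm_eq_half {v : EuclideanSpace ℝ (Fin c)} (hv : ‖v‖ = 1 / 2) :
    (((1 - ‖v‖) * ‖v‖⁻¹) • v) = v := by
  rw [hv, show (1 - 1 / 2 : ℝ) * (1 / 2)⁻¹ = 1 by norm_num, one_smul]

/-- `v = ‖v‖ • (v/‖v‖)` for `v ≠ 0`. [folklore] -/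
theorem norm_smul_inv_norm_smul {v : EuclideanSpace ℝ (Fin c)} (hv : v ≠ 0) :
    ‖v‖ • (‖v‖⁻¹ • v) = v := by
  rw [smul_smul, mul_inv_cancel₀ (norm_ne_zero_iff.2 hv), one_smul]

/-- `v/‖v‖` lies on the unit sphere for `v ≠ 0`. [folklore] -/
theorem inv_norm_smul_mem_sphere {v : EuclideanSpace ℝ (Fin c)} (hv : v ≠ 0) :
    ‖v‖⁻¹ • v ∈ sphere (0 : EuclideanSpace ℝ (Fin c)) 1 := by
  rw [mem_sphere_zero_iff_norm, norm_smul, norm_inv, norm_norm,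
    inv_mul_cancel₀ (norm_ne_zero_iff.2 hv)]

/-- **The radial flip is `C^∞` off the origin.** [folklore] -/
theorem contDiffAt_radialFlip {v : EuclideanSpace ℝ (Fin c)} (hv : v ≠ 0) :
    ContDiffAt ℝ ∞ (fun w : EuclideanSpace ℝ (Fin c) => (((1 - ‖w‖) * ‖w‖⁻¹) • w)) v :=
  ((contDiffAt_const.sub (contDiffAt_norm ℝ hv)).mul
    ((contDiffAt_norm ℝ hv).inv (norm_ne_zero_iff.2 hv))).smul contDiffAt_id

/-- The radial flip is `C^∞` on the complement of the origin. [folklore] -/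
theorem contDiffOn_radialFlip :
    ContDiffOn ℝ ∞ (fun w : EuclideanSpace ℝ (Fin c) => (((1 - ‖w‖) * ‖w‖⁻¹) • w)) {w | w ≠ 0} :=
  fun _ hw => (contDiffAt_radialFlip hw).contDiffWithinAt

end Flip

/-! ### §2 Tubes: the core, the punctured tube, the transition map -/

section Core

variable {c : ℕ} {Y : Type} [TopologicalSpace Y] {F : Type} [TopologicalSpace F]
  {T : F × EuclideanSpace ℝ (Fin c) → Y}

/-- The core `T(F × 0)` of a tube over a compact `F` is compact. [folklore] -/
theorem isCompact_range_core [CompactSpace F] (hT : Continuous T) :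
    IsCompact (range fun f : F => T (f, 0)) :=
  isCompact_range (hT.comp (continuous_id.prodMk continuous_const))

/-- The complement `Y ∖ T(F × 0)` of the core of a tube is open (`Y` Hausdorff, `F` compact).
[folklore] -/
theorem isOpen_compl_range_core [CompactSpace F] [T2Space Y] (hT : Continuous T) :
    IsOpen (range fun f : F => T (f, 0))ᶜ :=
  (isCompact_range_core hT).isClosed.isOpen_compl

omit [TopologicalSpace Y] [TopologicalSpace F] in
/-- `T(f, v)` lies on the core iff `v = 0`. [folklore] -/
theorem apply_mem_range_core_iff (hT : Injective T) {q : F × EuclideanSpace ℝ (Fin c)} :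
    T q ∈ range (fun f : F => T (f, 0)) ↔ q.2 = 0 := by
  constructor
  · rintro ⟨f, hf⟩
    have := congrArg Prod.snd (hT hf)
    exact this.symm
  · intro hq
    refine ⟨q.1, ?_⟩
    show T (q.1, 0) = T q
    rw [show ((q.1, (0 : EuclideanSpace ℝ (Fin c))) : F × EuclideanSpace ℝ (Fin c)) = q from
      Prod.ext rfl hq.symm]

/-- The punctured open unit tube `T(F × (B(0,1) ∖ 0))` is open, for an open embedding `T`.
[folklore] -/
theorem isOpen_image_puncturedTube (hT : Topology.IsOpenEmbedding T) :
    IsOpen (T '' {q : F × EuclideanSpace ℝ (Fin c) | q.2 ≠ 0 ∧ ‖q.2‖ < 1}) :=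
  hT.isOpenMap _ ((isOpen_ne.preimage continuous_snd).inter
    (isOpen_lt (continuous_norm.comp continuous_snd) continuous_const))

/-- The punctured tube `T(F × (ℝᶜ ∖ 0))` is open, for an open embedding `T`. [folklore] -/
theorem isOpen_image_ne_zero (hT : Topology.IsOpenEmbedding T) :
    IsOpen (T '' {q : F × EuclideanSpace ℝ (Fin c) | q.2 ≠ 0}) :=
  hT.isOpenMap _ (isOpen_ne.preimage continuous_snd)

/-- The open tube `T(F × B(0, r))` is open, for an open embedding `T`. [folklore] -/
theorem isOpen_image_norm_lt (hT : Topology.IsOpenEmbedding T) (r : ℝ) :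
    IsOpen (T '' {q : F × EuclideanSpace ℝ (Fin c) | ‖q.2‖ < r}) :=
  hT.isOpenMap _ (isOpen_lt (continuous_norm.comp continuous_snd) continuous_const)

end Core

section TubeAlgebra

variable {c : ℕ} {Y Y' F : Type} {T : F × EuclideanSpace ℝ (Fin c) → Y}
  {T' : F × EuclideanSpace ℝ (Fin c) → Y'} {g : Y → ℝ}

/-- **The transition map of two tubes on the tube of the first**:
`T(f, v) ↦ T'(f, ρ v)`. [folklore] -/
theorem transition_apply [Nonempty F] (hT : Injective T) (q : F × EuclideanSpace ℝ (Fin c)) :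
    T' ((invFun T (T q)).1,
      (((1 - ‖(invFun T (T q)).2‖) * ‖(invFun T (T q)).2‖⁻¹) • (invFun T (T q)).2)) =
      T' (q.1, (((1 - ‖q.2‖) * ‖q.2‖⁻¹) • q.2)) := by
  rw [leftInverse_invFun hT q]

/-- For a tube function, `¼ ≤ g (T q)` iff `½ ≤ ‖q.2‖`. [folklore] -/
theorem le_tubeFunction_apply_iff (hlt : ∀ x, g (T x) < 1 / 4 ↔ ‖x.2‖ < 1 / 2)
    (q : F × EuclideanSpace ℝ (Fin c)) : 1 / 4 ≤ g (T q) ↔ 1 / 2 ≤ ‖q.2‖ := by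
  rw [← not_lt, hlt, not_lt]

/-- For a tube function, a point with `g < 1` lies in the tube. [folklore] -/
theorem mem_range_of_tubeFunction_lt (hout : ∀ y, y ∉ range T → g y = 1) {y : Y}
    (hy : g y < 1) : y ∈ range T := by
  by_contra h
  rw [hout y h] at hy
  exact lt_irrefl _ hy

end TubeAlgebra

section Transition

variable {k d c : ℕ}
  {Y : Type} [TopologicalSpace Y] [ChartedSpace (EuclideanSpace ℝ (Fin (k + 1))) Y]
  {Y' : Type} [TopologicalSpace Y'] [ChartedSpace (EuclideanSpace ℝ (Fin (k + 1))) Y']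
  {F : Type} [TopologicalSpace F] [ChartedSpace (EuclideanSpace ℝ (Fin d)) F]
  {T : F × EuclideanSpace ℝ (Fin c) → Y} {T' : F × EuclideanSpace ℝ (Fin c) → Y'}

/-- **The transition map `T' ∘ (id × ρ) ∘ T⁻¹` is `C^∞` on the punctured tube `T(F × (ℝᶜ ∖ 0))`**
(the inverse of the smooth embedding `T` is `C^∞` on its range, `contMDiffOn_invFun_range`;
the flip is `C^∞` off `0`). [folklore] -/
theorem contMDiffOn_transition [Nonempty F]
    (hT : Manifold.IsSmoothEmbedding ((𝓡 d).prod (𝓡 c)) (𝓡 (k + 1)) ∞ T)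
    (hT' : Manifold.IsSmoothEmbedding ((𝓡 d).prod (𝓡 c)) (𝓡 (k + 1)) ∞ T') :
    ContMDiffOn (𝓡 (k + 1)) (𝓡 (k + 1)) ∞
      (fun y : Y => T' ((invFun T y).1,
        (((1 - ‖(invFun T y).2‖) * ‖(invFun T y).2‖⁻¹) • (invFun T y).2)))
      (T '' {q : F × EuclideanSpace ℝ (Fin c) | q.2 ≠ 0}) := by
  have hflip : ContMDiffOn ((𝓡 d).prod (𝓡 c)) ((𝓡 d).prod (𝓡 c)) ∞
      (fun q : F × EuclideanSpace ℝ (Fin c) =>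
        ((q.1, (((1 - ‖q.2‖) * ‖q.2‖⁻¹) • q.2)) : F × EuclideanSpace ℝ (Fin c)))
      {q | q.2 ≠ 0} := by
    refine contMDiffOn_fst.prodMk fun q hq => ?_
    exact ((contDiffAt_radialFlip hq).contMDiffAt.comp q contMDiffAt_snd).contMDiffWithinAt
  have hinv : ContMDiffOn (𝓡 (k + 1)) ((𝓡 d).prod (𝓡 c)) ∞ (invFun T) (T '' {q | q.2 ≠ 0}) :=
    (Literature.Geometry.Manifold.contMDiffOn_invFun_range hT).mono (image_subset_range _ _)
  refine (hT'.contMDiff.comp_contMDiffOn hflip).comp hinv ?_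
  rintro _ ⟨q, hq, rfl⟩
  show invFun T (T q) ∈ {q : F × EuclideanSpace ℝ (Fin c) | q.2 ≠ 0}
  rw [leftInverse_invFun hT.isEmbedding.injective q]
  exact hq

end Transition

/-! ### §3 The open gluing datum of two tubes -/

section GlueData

variable {k d c : ℕ}
  {Y₁ : Type} [TopologicalSpace Y₁] [ChartedSpace (EuclideanSpace ℝ (Fin (k + 1))) Y₁]
  {Y₂ : Type} [TopologicalSpace Y₂] [ChartedSpace (EuclideanSpace ℝ (Fin (k + 1))) Y₂]
  {F : Type} [TopologicalSpace F] [ChartedSpace (EuclideanSpace ℝ (Fin d)) F]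
  {T₁ : F × EuclideanSpace ℝ (Fin c) → Y₁} {T₂ : F × EuclideanSpace ℝ (Fin c) → Y₂}

/-- **The corestricted transition map is `C^∞` into the open piece.**  Let `A' ⊆ Y'` be an open
set and `φ : Y → A'` a map which agrees with the transition map `T' ∘ (id × ρ) ∘ T⁻¹` (after the
inclusion `A' ⊆ Y'`) on the punctured unit tube `T(F × (B(0,1) ∖ 0))`; then `φ`, restricted to
any open piece `A ⊆ Y`, is `C^∞` on the punctured unit tube. [folklore] -/
theorem contMDiffOn_corestrict_transition [Nonempty F]
    (hT : Manifold.IsSmoothEmbedding ((𝓡 d).prod (𝓡 c)) (𝓡 (k + 1)) ∞ T₁)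
    (hTo : IsOpen (range T₁))
    (hT' : Manifold.IsSmoothEmbedding ((𝓡 d).prod (𝓡 c)) (𝓡 (k + 1)) ∞ T₂)
    (A : TopologicalSpace.Opens Y₁) (A' : TopologicalSpace.Opens Y₂) (φ : Y₁ → A')
    (hφ : ∀ q : F × EuclideanSpace ℝ (Fin c), q.2 ≠ 0 → ‖q.2‖ < 1 →
      (φ (T₁ q) : Y₂) = T₂ (q.1, (((1 - ‖q.2‖) * ‖q.2‖⁻¹) • q.2))) :
    ContMDiffOn (𝓡 (k + 1)) (𝓡 (k + 1)) ∞ (fun a : A => φ a)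
      {a : A | (a : Y₁) ∈ T₁ '' {q : F × EuclideanSpace ℝ (Fin c) | q.2 ≠ 0 ∧ ‖q.2‖ < 1}} := by
  have hopen : IsOpen (T₁ '' {q : F × EuclideanSpace ℝ (Fin c) | q.2 ≠ 0 ∧ ‖q.2‖ < 1}) :=
    isOpen_image_puncturedTube ⟨hT.isEmbedding, hTo⟩
  intro a ha
  refine (contMDiffAt_subtype_iff.2 ?_).contMDiffWithinAt
  rw [← ContMDiffAt.subtypeVal_comp_iff]
  have hev : (Subtype.val ∘ φ) =ᶠ[𝓝 (a : Y₁)]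
      fun y : Y₁ => T₂ ((invFun T₁ y).1,
        (((1 - ‖(invFun T₁ y).2‖) * ‖(invFun T₁ y).2‖⁻¹) • (invFun T₁ y).2)) := by
    filter_upwards [hopen.mem_nhds ha]
    rintro _ ⟨q, hq, rfl⟩
    simp only [Function.comp_apply]
    rw [hφ q hq.1 hq.2, transition_apply (T' := T₂) hT.isEmbedding.injective]
  refine ContMDiffAt.congr_of_eventuallyEq ?_ hev
  exact (contMDiffOn_transition hT hT').contMDiffAt
    ((isOpen_image_ne_zero ⟨hT.isEmbedding, hTo⟩).mem_nhds (image_mono (fun q hq => hq.1) ha))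

/-- The parametrisation `(f, u, t) ↦ (T₁(f, t u), T₂(f, (1 - t) u))` of the closure of the graph
of the gluing map by the compact space `F × Sᶜ⁻¹ × [0, 1]` is continuous. [folklore] -/
theorem continuous_graphParam (h₁ : Continuous T₁) (h₂ : Continuous T₂) :
    Continuous fun r : F × (sphere (0 : EuclideanSpace ℝ (Fin c)) 1) × (Icc (0 : ℝ) 1) =>
      ((T₁ (r.1, (r.2.2 : ℝ) • (r.2.1 : EuclideanSpace ℝ (Fin c))),
        T₂ (r.1, (1 - (r.2.2 : ℝ)) • (r.2.1 : EuclideanSpace ℝ (Fin c)))) :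
        Y₁ × Y₂) := by
  fun_prop

/-- **The graph of the gluing map is closed in `A₁ × A₂`.**  For the open pieces
`Aᵢ = Yᵢ ∖ Tᵢ(F × 0)` and any map `φ : A₁ → A₂` agreeing with the transition map on the punctured
unit tube, the set `{(a, φ a) | a ∈ T₁(F × (B ∖ 0))}` is closed in `A₁ × A₂`: it is the trace on
`A₁ × A₂` of the compact set `{(T₁(f, t u), T₂(f, (1 - t) u))}`, whose points with `t = 0` resp.
`t = 1` have a coordinate on a removed core (Kosinski VI.1: the Hausdorff condition for the
pushout). [folklore] -/
theorem isClosed_graph_transition [CompactSpace F] [T2Space Y₁] [T2Space Y₂]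
    (hT₁ : Topology.IsEmbedding T₁) (hT₂ : Topology.IsEmbedding T₂)
    (A₁ : TopologicalSpace.Opens Y₁) (A₂ : TopologicalSpace.Opens Y₂)
    (hA₁ : (A₁ : Set Y₁) = (range fun f : F => T₁ (f, 0))ᶜ)
    (hA₂ : (A₂ : Set Y₂) = (range fun f : F => T₂ (f, 0))ᶜ)
    (φ : A₁ → A₂)
    (hφ : ∀ (a : A₁) (q : F × EuclideanSpace ℝ (Fin c)), q.2 ≠ 0 → ‖q.2‖ < 1 → (a : Y₁) = T₁ q →
      (φ a : Y₂) = T₂ (q.1, (((1 - ‖q.2‖) * ‖q.2‖⁻¹) • q.2))) :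
    IsClosed {p : A₁ × A₂ |
      (p.1 : Y₁) ∈ T₁ '' {q : F × EuclideanSpace ℝ (Fin c) | q.2 ≠ 0 ∧ ‖q.2‖ < 1} ∧
        φ p.1 = p.2} := by
  have hc : IsClosed (range
      fun r : F × (sphere (0 : EuclideanSpace ℝ (Fin c)) 1) × (Icc (0 : ℝ) 1) =>
      ((T₁ (r.1, (r.2.2 : ℝ) • (r.2.1 : EuclideanSpace ℝ (Fin c))),
        T₂ (r.1, (1 - (r.2.2 : ℝ)) • (r.2.1 : EuclideanSpace ℝ (Fin c)))) :
        Y₁ × Y₂)) :=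
    (isCompact_range (continuous_graphParam hT₁.continuous hT₂.continuous)).isClosed
  have hcont : Continuous fun p : A₁ × A₂ => (((p.1 : Y₁), (p.2 : Y₂)) : Y₁ × Y₂) := by fun_prop
  convert hc.preimage hcont using 1
  ext ⟨a, b⟩
  simp only [mem_setOf_eq, mem_preimage, mem_range]
  constructor
  · rintro ⟨⟨q, ⟨hq0, hq1⟩, hqa⟩, hab⟩
    have hφa := hφ a q hq0 hq1 hqa.symm
    refine ⟨(q.1, ⟨‖q.2‖⁻¹ • q.2, inv_norm_smul_mem_sphere hq0⟩, ⟨‖q.2‖, norm_nonneg _, hq1.le⟩),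
      ?_⟩
    simp only [Prod.mk.injEq]
    refine ⟨?_, ?_⟩
    · rw [norm_smul_inv_norm_smul hq0]; exact hqa
    · rw [← hab, hφa, radialFlip_eq_smul_smul]
  · rintro ⟨⟨f, u, t, ht0, ht1⟩, h⟩
    simp only [Prod.mk.injEq] at h
    obtain ⟨ha, hb⟩ := h
    have hu : ‖(u : EuclideanSpace ℝ (Fin c))‖ = 1 := mem_sphere_zero_iff_norm.1 u.2
    have ht0' : 0 < t := by
      rcases ht0.lt_or_eq with h | rfl
      · exact h
      · exfalso
        have hmem : (a : Y₁) ∈ (A₁ : Set Y₁) := a.2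
        rw [hA₁] at hmem
        exact hmem ⟨f, by rw [← ha]; simp⟩
    have ht1' : t < 1 := by
      rcases ht1.lt_or_eq with h | rfl
      · exact h
      · exfalso
        have hmem : (b : Y₂) ∈ (A₂ : Set Y₂) := b.2
        rw [hA₂] at hmem
        exact hmem ⟨f, by rw [← hb]; simp⟩
    have hv0 : t • (u : EuclideanSpace ℝ (Fin c)) ≠ 0 := by
      rw [← norm_ne_zero_iff, norm_smul, hu, mul_one, Real.norm_of_nonneg ht0]
      exact ht0'.ne'
    have hnv : ‖t • (u : EuclideanSpace ℝ (Fin c))‖ = t := by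
      rw [norm_smul, hu, mul_one, Real.norm_of_nonneg ht0]
    have hv1 : ‖t • (u : EuclideanSpace ℝ (Fin c))‖ < 1 := by rw [hnv]; exact ht1'
    refine ⟨⟨(f, t • (u : EuclideanSpace ℝ (Fin c))), ⟨hv0, hv1⟩, ha⟩, ?_⟩
    ext1
    rw [hφ a (f, t • (u : EuclideanSpace ℝ (Fin c))) hv0 hv1 ha.symm, ← hb]
    dsimp only
    rw [radialFlip_eq_smul_smul, hnv, inv_smul_smul₀ ht0'.ne']

/-- The trace `{a ∈ A | a ∉ T(F × B(0, ½))}` of the complement of the open half tube on an open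
piece `A ⊇ Y ∖ T(F × B(0, ½))` of a compact `Y` is compact. [folklore] -/
theorem isCompact_preimage_compl_halfTube [CompactSpace Y₁] (hT : Topology.IsOpenEmbedding T₁)
    (A : TopologicalSpace.Opens Y₁)
    (hA : (T₁ '' {q : F × EuclideanSpace ℝ (Fin c) | ‖q.2‖ < 1 / 2})ᶜ ⊆ (A : Set Y₁)) :
    IsCompact {a : A | (a : Y₁) ∉ T₁ '' {q : F × EuclideanSpace ℝ (Fin c) | ‖q.2‖ < 1 / 2}} := by
  refine Topology.IsInducing.subtypeVal.isCompact_preimage'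
    (isOpen_image_norm_lt hT (1 / 2)).isClosed_compl.isCompact ?_
  intro x hx
  exact ⟨⟨x, hA hx⟩, rfl⟩

/-- **The open gluing datum of two tubes.**  Let `T₁ : F × ℝᶜ → Y₁`, `T₂ : F × ℝᶜ → Y₂` be
smooth open embeddings (`F` compact, `Yᵢ` closed, `c ≥ 1`) and `Aᵢ = Yᵢ ∖ Tᵢ(F × 0)` the
complements of the cores, open submanifolds.  There is a gluing datum
`D : SmoothGlueData (𝓡 _) (𝓡 _) A₁ A₂ ℝᵏ⁺¹` (`GluingConstruction.lean`) whose gluing map is the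
transition map `T₁(f, v) ↦ T₂(f, ρ v)` between the punctured unit tubes
`Tᵢ(F × (B(0,1) ∖ 0))` (inverse `T₂(f, v) ↦ T₁(f, ρ v)`, the flip being an involution), and whose
glued space `A₁ ∪_D A₂` — **the fibre sum `Y₁ #_F Y₂`** — is Hausdorff, compact and second
countable (Gompf 1995 §1: "identify the punctured tubular neighbourhoods by the
orientation-reversing diffeomorphism `r ↦ 1 - r` of the radial coordinate"; Kosinski 1993 VI.1).
[cite: Gompf1995, §1] -/
theorem exists_smoothGlueData_tubes [Nonempty F] [CompactSpace F] [T2Space Y₁] [T2Space Y₂]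
    [CompactSpace Y₁] [CompactSpace Y₂] [IsManifold (𝓡 (k + 1)) ∞ Y₁]
    [IsManifold (𝓡 (k + 1)) ∞ Y₂] (hc : 0 < c)
    (hT₁ : Manifold.IsSmoothEmbedding ((𝓡 d).prod (𝓡 c)) (𝓡 (k + 1)) ∞ T₁)
    (hT₁o : IsOpen (range T₁))
    (hT₂ : Manifold.IsSmoothEmbedding ((𝓡 d).prod (𝓡 c)) (𝓡 (k + 1)) ∞ T₂)
    (hT₂o : IsOpen (range T₂))
    (A₁ : TopologicalSpace.Opens Y₁) (A₂ : TopologicalSpace.Opens Y₂)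
    (hA₁ : (A₁ : Set Y₁) = (range fun f : F => T₁ (f, 0))ᶜ)
    (hA₂ : (A₂ : Set Y₂) = (range fun f : F => T₂ (f, 0))ᶜ) :
    ∃ D : SmoothGlueData (𝓡 (k + 1)) (𝓡 (k + 1)) A₁ A₂ (EuclideanSpace ℝ (Fin (k + 1))),
      D.glue.source =
          {a : A₁ | (a : Y₁) ∈ T₁ '' {q : F × EuclideanSpace ℝ (Fin c) | q.2 ≠ 0 ∧ ‖q.2‖ < 1}} ∧
      D.glue.target =
          {b : A₂ | (b : Y₂) ∈ T₂ '' {q : F × EuclideanSpace ℝ (Fin c) | q.2 ≠ 0 ∧ ‖q.2‖ < 1}} ∧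
      (∀ (a : A₁) (q : F × EuclideanSpace ℝ (Fin c)), q.2 ≠ 0 → ‖q.2‖ < 1 → (a : Y₁) = T₁ q →
        (D.glue a : Y₂) = T₂ (q.1, (((1 - ‖q.2‖) * ‖q.2‖⁻¹) • q.2))) ∧
      (∀ (b : A₂) (q : F × EuclideanSpace ℝ (Fin c)), q.2 ≠ 0 → ‖q.2‖ < 1 → (b : Y₂) = T₂ q →
        (D.glue.symm b : Y₁) = T₁ (q.1, (((1 - ‖q.2‖) * ‖q.2‖⁻¹) • q.2))) ∧
      T2Space D.Glued ∧ CompactSpace D.Glued ∧ SecondCountableTopology D.Glued := by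
  classical
  have hi₁ : Injective T₁ := hT₁.isEmbedding.injective
  have hi₂ : Injective T₂ := hT₂.isEmbedding.injective
  have hoe₁ : Topology.IsOpenEmbedding T₁ := ⟨hT₁.isEmbedding, hT₁o⟩
  have hoe₂ : Topology.IsOpenEmbedding T₂ := ⟨hT₂.isEmbedding, hT₂o⟩
  -- membership in the pieces
  have hmemA₁ : ∀ q : F × EuclideanSpace ℝ (Fin c), T₁ q ∈ A₁ ↔ q.2 ≠ 0 := fun q => by
    rw [← SetLike.mem_coe, hA₁, mem_compl_iff, apply_mem_range_core_iff hi₁]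
  have hmemA₂ : ∀ q : F × EuclideanSpace ℝ (Fin c), T₂ q ∈ A₂ ↔ q.2 ≠ 0 := fun q => by
    rw [← SetLike.mem_coe, hA₂, mem_compl_iff, apply_mem_range_core_iff hi₂]
  -- base points (junk values): `Tᵢ (f₀, v₀)` with `v₀ ≠ 0`
  haveI : Nontrivial (EuclideanSpace ℝ (Fin c)) :=
    Module.nontrivial_of_finrank_pos (R := ℝ) (by rw [finrank_euclideanSpace_fin]; exact hc)
  obtain ⟨v₀, hv₀0⟩ := exists_ne (0 : EuclideanSpace ℝ (Fin c))
  set f₀ : F := Classical.arbitrary F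
  let a₀ : A₁ := ⟨T₁ (f₀, v₀), (hmemA₁ _).2 hv₀0⟩
  let b₀ : A₂ := ⟨T₂ (f₀, v₀), (hmemA₂ _).2 hv₀0⟩
  -- the two corestricted transition maps
  let φ : Y₁ → A₂ := fun y =>
    if h : T₂ ((invFun T₁ y).1,
        (((1 - ‖(invFun T₁ y).2‖) * ‖(invFun T₁ y).2‖⁻¹) • (invFun T₁ y).2)) ∈ A₂
      then ⟨_, h⟩ else b₀
  let φ' : Y₂ → A₁ := fun y =>
    if h : T₁ ((invFun T₂ y).1,
        (((1 - ‖(invFun T₂ y).2‖) * ‖(invFun T₂ y).2‖⁻¹) • (invFun T₂ y).2)) ∈ A₁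
      then ⟨_, h⟩ else a₀
  have hφ : ∀ q : F × EuclideanSpace ℝ (Fin c), q.2 ≠ 0 → ‖q.2‖ < 1 →
      (φ (T₁ q) : Y₂) = T₂ (q.1, (((1 - ‖q.2‖) * ‖q.2‖⁻¹) • q.2)) := by
    intro q hq0 hq1
    have hmem : T₂ ((invFun T₁ (T₁ q)).1,
        (((1 - ‖(invFun T₁ (T₁ q)).2‖) * ‖(invFun T₁ (T₁ q)).2‖⁻¹) • (invFun T₁ (T₁ q)).2)) ∈ A₂ := by
      rw [transition_apply (T' := T₂) hi₁, hmemA₂]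
      exact radialFlip_ne_zero hq0 hq1
    simp only [φ, dif_pos hmem]
    exact transition_apply hi₁ q
  have hφ' : ∀ q : F × EuclideanSpace ℝ (Fin c), q.2 ≠ 0 → ‖q.2‖ < 1 →
      (φ' (T₂ q) : Y₁) = T₁ (q.1, (((1 - ‖q.2‖) * ‖q.2‖⁻¹) • q.2)) := by
    intro q hq0 hq1
    have hmem : T₁ ((invFun T₂ (T₂ q)).1,
        (((1 - ‖(invFun T₂ (T₂ q)).2‖) * ‖(invFun T₂ (T₂ q)).2‖⁻¹) • (invFun T₂ (T₂ q)).2)) ∈ A₁ := by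
      rw [transition_apply (T' := T₁) hi₂, hmemA₁]
      exact radialFlip_ne_zero hq0 hq1
    simp only [φ', dif_pos hmem]
    exact transition_apply hi₂ q
  -- the punctured unit tubes
  set U : Set (F × EuclideanSpace ℝ (Fin c)) := {q | q.2 ≠ 0 ∧ ‖q.2‖ < 1} with hU
  have hflipU :
      ∀ q ∈ U, ((q.1, (((1 - ‖q.2‖) * ‖q.2‖⁻¹) • q.2)) : F × EuclideanSpace ℝ (Fin c)) ∈ U :=
    fun q hq =>
    ⟨radialFlip_ne_zero hq.1 hq.2, norm_radialFlip_lt_one hq.1 hq.2.le⟩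
  -- the gluing map
  let G : OpenPartialHomeomorph A₁ A₂ :=
  { toFun := fun a => φ a
    invFun := fun b => φ' b
    source := {a : A₁ | (a : Y₁) ∈ T₁ '' U}
    target := {b : A₂ | (b : Y₂) ∈ T₂ '' U}
    map_source' := by
      rintro a ⟨q, hq, hqa⟩
      show (φ a : Y₂) ∈ T₂ '' U
      rw [← hqa, hφ q hq.1 hq.2]
      exact ⟨_, hflipU q hq, rfl⟩
    map_target' := by
      rintro b ⟨q, hq, hqb⟩
      show (φ' b : Y₁) ∈ T₁ '' U
      rw [← hqb, hφ' q hq.1 hq.2]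
      exact ⟨_, hflipU q hq, rfl⟩
    left_inv' := by
      rintro a ⟨q, hq, hqa⟩
      ext1
      show (φ' (φ a) : Y₁) = a
      rw [← hqa, hφ q hq.1 hq.2, hφ' _ (hflipU q hq).1 (hflipU q hq).2]
      show T₁ (q.1, (((1 - ‖(((1 - ‖q.2‖) * ‖q.2‖⁻¹) • q.2)‖) *
        ‖(((1 - ‖q.2‖) * ‖q.2‖⁻¹) • q.2)‖⁻¹) • (((1 - ‖q.2‖) * ‖q.2‖⁻¹) • q.2))) = T₁ q
      congr 1
      exact Prod.ext rfl (radialFlip_radialFlip hq.1 hq.2)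
    right_inv' := by
      rintro b ⟨q, hq, hqb⟩
      ext1
      show (φ (φ' b) : Y₂) = b
      rw [← hqb, hφ' q hq.1 hq.2, hφ _ (hflipU q hq).1 (hflipU q hq).2]
      show T₂ (q.1, (((1 - ‖(((1 - ‖q.2‖) * ‖q.2‖⁻¹) • q.2)‖) *
        ‖(((1 - ‖q.2‖) * ‖q.2‖⁻¹) • q.2)‖⁻¹) • (((1 - ‖q.2‖) * ‖q.2‖⁻¹) • q.2))) = T₂ q
      congr 1
      exact Prod.ext rfl (radialFlip_radialFlip hq.1 hq.2)
    open_source := (isOpen_image_puncturedTube hoe₁).preimage continuous_subtype_val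
    open_target := (isOpen_image_puncturedTube hoe₂).preimage continuous_subtype_val
    continuousOn_toFun :=
      (contMDiffOn_corestrict_transition hT₁ hT₁o hT₂ A₁ A₂ φ hφ).continuousOn
    continuousOn_invFun :=
      (contMDiffOn_corestrict_transition hT₂ hT₂o hT₁ A₂ A₁ φ' hφ').continuousOn }
  let D : SmoothGlueData (𝓡 (k + 1)) (𝓡 (k + 1)) A₁ A₂ (EuclideanSpace ℝ (Fin (k + 1))) :=
  { glue := G
    contMDiffOn_glue := contMDiffOn_corestrict_transition hT₁ hT₁o hT₂ A₁ A₂ φ hφ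
    contMDiffOn_glue_symm := contMDiffOn_corestrict_transition hT₂ hT₂o hT₁ A₂ A₁ φ' hφ'
    linA := ContinuousLinearEquiv.refl ℝ _
    linB := ContinuousLinearEquiv.refl ℝ _ }
  have hglue : ∀ (a : A₁) (q : F × EuclideanSpace ℝ (Fin c)), q.2 ≠ 0 → ‖q.2‖ < 1 →
      (a : Y₁) = T₁ q →
      (D.glue a : Y₂) = T₂ (q.1, (((1 - ‖q.2‖) * ‖q.2‖⁻¹) • q.2)) := by
    intro a q hq0 hq1 hqa
    show (φ a : Y₂) = _
    rw [hqa]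
    exact hφ q hq0 hq1
  have hglue' : ∀ (b : A₂) (q : F × EuclideanSpace ℝ (Fin c)), q.2 ≠ 0 → ‖q.2‖ < 1 →
      (b : Y₂) = T₂ q →
      (D.glue.symm b : Y₁) = T₁ (q.1, (((1 - ‖q.2‖) * ‖q.2‖⁻¹) • q.2)) := by
    intro b q hq0 hq1 hqb
    show (φ' b : Y₁) = _
    rw [hqb]
    exact hφ' q hq0 hq1
  -- Hausdorff
  have hT2 : T2Space D.Glued :=
    D.t2Space_of_isClosed_graph
      (isClosed_graph_transition hT₁.isEmbedding hT₂.isEmbedding A₁ A₂ hA₁ hA₂ (fun a => φ a)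
        (fun a q hq0 hq1 hqa => by
          show (φ a : Y₂) = T₂ (q.1, (((1 - ‖q.2‖) * ‖q.2‖⁻¹) • q.2))
          rw [hqa]
          exact hφ q hq0 hq1))
  -- compact: the images of `Yᵢ ∖ Tᵢ(F × B(0, ½))` cover
  have hsub₁ : (T₁ '' {q : F × EuclideanSpace ℝ (Fin c) | ‖q.2‖ < 1 / 2})ᶜ ⊆ (A₁ : Set Y₁) := by
    rw [hA₁]
    refine compl_subset_compl.2 ?_
    rintro _ ⟨f, rfl⟩
    exact ⟨(f, 0), by norm_num, rfl⟩
  have hsub₂ : (T₂ '' {q : F × EuclideanSpace ℝ (Fin c) | ‖q.2‖ < 1 / 2})ᶜ ⊆ (A₂ : Set Y₂) := by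
    rw [hA₂]
    refine compl_subset_compl.2 ?_
    rintro _ ⟨f, rfl⟩
    exact ⟨(f, 0), by norm_num, rfl⟩
  have hcpt : CompactSpace D.Glued := by
    refine D.compactSpace_of_forall_not_mem (isCompact_preimage_compl_halfTube hoe₁ A₁ hsub₁)
      (isCompact_preimage_compl_halfTube hoe₂ A₂ hsub₂) ?_ ?_
    · intro a ha
      simp only [mem_setOf_eq, not_not] at ha
      obtain ⟨q, hq, hqa⟩ := ha
      have hq' : ‖q.2‖ < 1 / 2 := hq
      have hq0 : q.2 ≠ 0 := (hmemA₁ q).1 (hqa ▸ a.2)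
      have hq1 : ‖q.2‖ < 1 := hq'.trans (by norm_num)
      refine ⟨⟨q, ⟨hq0, hq1⟩, hqa⟩, ?_⟩
      show (D.glue a : Y₂) ∉ T₂ '' {q : F × EuclideanSpace ℝ (Fin c) | ‖q.2‖ < 1 / 2}
      rw [hglue a q hq0 hq1 hqa.symm]
      rintro ⟨q', hq'', he⟩
      have := congrArg (fun p : F × EuclideanSpace ℝ (Fin c) => ‖p.2‖) (hi₂ he)
      dsimp only at this
      rw [norm_radialFlip hq0 hq1.le] at this
      have : ‖q'.2‖ < 1 / 2 := hq''
      linarith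
    · intro b hb
      simp only [mem_setOf_eq, not_not] at hb
      obtain ⟨q, hq, hqb⟩ := hb
      have hq' : ‖q.2‖ < 1 / 2 := hq
      have hq0 : q.2 ≠ 0 := (hmemA₂ q).1 (hqb ▸ b.2)
      have hq1 : ‖q.2‖ < 1 := hq'.trans (by norm_num)
      refine ⟨⟨q, ⟨hq0, hq1⟩, hqb⟩, ?_⟩
      show (D.glue.symm b : Y₁) ∉ T₁ '' {q : F × EuclideanSpace ℝ (Fin c) | ‖q.2‖ < 1 / 2}
      rw [hglue' b q hq0 hq1 hqb.symm]
      rintro ⟨q', hq'', he⟩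
      have := congrArg (fun p : F × EuclideanSpace ℝ (Fin c) => ‖p.2‖) (hi₁ he)
      dsimp only at this
      rw [norm_radialFlip hq0 hq1.le] at this
      have : ‖q'.2‖ < 1 / 2 := hq''
      linarith
  haveI := hcpt
  exact ⟨D, rfl, rfl, hglue, hglue', hT2, hcpt, D.secondCountableTopology⟩

end GlueData

/-! ### §4 The fibre sum as a boundary gluing of the two tube complements -/

section FibreSum

variable {k d c : ℕ}
  {Y₁ : Type} [TopologicalSpace Y₁] [T2Space Y₁] [ChartedSpace (EuclideanSpace ℝ (Fin (k + 1))) Y₁]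
  [IsManifold (𝓡 (k + 1)) ∞ Y₁] [CompactSpace Y₁]
  {Y₂ : Type} [TopologicalSpace Y₂] [T2Space Y₂] [ChartedSpace (EuclideanSpace ℝ (Fin (k + 1))) Y₂]
  [IsManifold (𝓡 (k + 1)) ∞ Y₂] [CompactSpace Y₂]
  {F : Type} [TopologicalSpace F] [CompactSpace F] [Nonempty F]
  [ChartedSpace (EuclideanSpace ℝ (Fin d)) F]
  {T₁ : F × EuclideanSpace ℝ (Fin c) → Y₁} {T₂ : F × EuclideanSpace ℝ (Fin c) → Y₂}
  {g₁ : Y₁ → ℝ} {g₂ : Y₂ → ℝ}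

/-- **The fibre sum of two closed manifolds along a framed compact submanifold exists, as a
gluing of the two tube complements along their boundaries.**  Let `T₁ : F × ℝᶜ → Y₁`,
`T₂ : F × ℝᶜ → Y₂` be smooth open embeddings of the product of a compact manifold `F` with `ℝᶜ`
(`c ≥ 1`) into closed smooth `(k+1)`-manifolds, and `g₁`, `g₂` tube functions for them (regular
level `¼`, `{gᵢ ∘ Tᵢ ≤ ¼} = {‖v‖ ≤ ½}`, `{gᵢ ∘ Tᵢ < ¼} = {‖v‖ < ½}`, `gᵢ ≡ 1` off the tube;
`exists_tube_function`).  Then there are a closed (compact, Hausdorff, second countable) smooth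
`(k+1)`-manifold `X` — the fibre sum `Y₁ #_F Y₂` of §3 — a bijection `ψ` between the boundaries
`∂{¼ ≤ g₁} = T₁(F × S(0, ½))` and `∂{¼ ≤ g₂} = T₂(F × S(0, ½))` of the two tube complements
given by `ψ(T₁(f, v)) = T₂(f, v)`, and gluing data `G : BoundaryGluingData _ _ ψ X` exhibiting
`X` as the gluing `{¼ ≤ g₁} ∪_ψ {¼ ≤ g₂}` of the two regular superlevel sets
(`RegularLevelSplitting.lean`) along their boundaries: `jA = inl ∘ incl`, `jB = inr ∘ incl` are
smooth embeddings covering `X` and meeting exactly along `T₁(F × S(0, ½)) ≡_ψ T₂(F × S(0, ½))`.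
This is the datum `(X m, ψ m, G m)` of
`Literature.Barriers.SmoothPoincare4.akhmedovPark2010_lemma8_invariants_of_blocks_vanKampen`
(Akhmedov–Park 2010, §9: "we take the normal connected sum `X₁(m) = Y₁(1,1) #_ψ Z''(1,m)` …
along the genus two surfaces"), and the hypothesis of the fibre-sum theorems of
`SignatureCupTrivialPieces.lean`, `OrientableBoundaryGluing.lean`, `BoundaryGluingVanKampen.lean`.
[cite: Gompf1995, §1] [cite: AkhmedovPark2010, §9] -/
theorem exists_fibreSum_boundaryGluingData (hc : 0 < c)
    (hT₁ : Manifold.IsSmoothEmbedding ((𝓡 d).prod (𝓡 c)) (𝓡 (k + 1)) ∞ T₁)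
    (hT₁o : IsOpen (range T₁))
    (hT₂ : Manifold.IsSmoothEmbedding ((𝓡 d).prod (𝓡 c)) (𝓡 (k + 1)) ∞ T₂)
    (hT₂o : IsOpen (range T₂))
    (hreg₁ : IsRegularLevel (𝓡 (k + 1)) g₁ (1 / 4))
    (hle₁ : ∀ x, g₁ (T₁ x) ≤ 1 / 4 ↔ ‖x.2‖ ≤ 1 / 2) (hlt₁ : ∀ x, g₁ (T₁ x) < 1 / 4 ↔ ‖x.2‖ < 1 / 2)
    (hout₁ : ∀ y, y ∉ range T₁ → g₁ y = 1)
    (hreg₂ : IsRegularLevel (𝓡 (k + 1)) g₂ (1 / 4))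
    (hle₂ : ∀ x, g₂ (T₂ x) ≤ 1 / 4 ↔ ‖x.2‖ ≤ 1 / 2) (hlt₂ : ∀ x, g₂ (T₂ x) < 1 / 4 ↔ ‖x.2‖ < 1 / 2)
    (hout₂ : ∀ y, y ∉ range T₂ → g₂ y = 1) :
    ∃ (X : Type) (_ : TopologicalSpace X) (_ : T2Space X) (_ : SecondCountableTopology X)
      (_ : CompactSpace X) (_ : ChartedSpace (EuclideanSpace ℝ (Fin (k + 1))) X)
      (_ : IsManifold (𝓡 (k + 1)) ∞ X)
      (ψ : (RegularSublevel.boundaryData hreg₁.const_sub).carrier ≃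
        (RegularSublevel.boundaryData hreg₂.const_sub).carrier)
      (_ : BoundaryGluingData (RegularSublevel.boundaryData hreg₁.const_sub)
        (RegularSublevel.boundaryData hreg₂.const_sub) ψ X),
      ∀ (z : (RegularSublevel.boundaryData hreg₁.const_sub).carrier)
        (q : F × EuclideanSpace ℝ (Fin c)),
        RegularSublevel.incl hreg₁.const_sub z.1 = T₁ q →
          RegularSublevel.incl hreg₂.const_sub (ψ z).1 = T₂ q := by
  classical
  have hi₁ : Injective T₁ := hT₁.isEmbedding.injective
  have hi₂ : Injective T₂ := hT₂.isEmbedding.injective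
  -- the open pieces and the gluing datum of §3
  let A₁ : TopologicalSpace.Opens Y₁ :=
    ⟨(range fun f : F => T₁ (f, 0))ᶜ, isOpen_compl_range_core hT₁.isEmbedding.continuous⟩
  let A₂ : TopologicalSpace.Opens Y₂ :=
    ⟨(range fun f : F => T₂ (f, 0))ᶜ, isOpen_compl_range_core hT₂.isEmbedding.continuous⟩
  obtain ⟨D, hsrc, htgt, hglue, -, hT2, hcpt, hsc⟩ :=
    exists_smoothGlueData_tubes hc hT₁ hT₁o hT₂ hT₂o A₁ A₂ rfl rfl
  haveI := hT2
  haveI := hcpt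
  haveI := hsc
  have hmemA₁ : ∀ q : F × EuclideanSpace ℝ (Fin c), T₁ q ∈ A₁ ↔ q.2 ≠ 0 := fun q => by
    show T₁ q ∈ (range fun f : F => T₁ (f, 0))ᶜ ↔ _
    rw [mem_compl_iff, apply_mem_range_core_iff hi₁]
  have hmemA₂ : ∀ q : F × EuclideanSpace ℝ (Fin c), T₂ q ∈ A₂ ↔ q.2 ≠ 0 := fun q => by
    show T₂ q ∈ (range fun f : F => T₂ (f, 0))ᶜ ↔ _
    rw [mem_compl_iff, apply_mem_range_core_iff hi₂]
  -- notation for the two superlevel sets `Mᵢ = {¼ ≤ gᵢ}` and their boundaries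
  set h₁ := hreg₁.const_sub with hh₁
  set h₂ := hreg₂.const_sub with hh₂
  have hsup₁ : ∀ p : RegularSuperlevel hreg₁, 1 / 4 ≤ g₁ (RegularSublevel.incl h₁ p) := fun p =>
    sub_nonpos.1 (RegularSublevel.apply_incl_le h₁ p)
  have hsup₂ : ∀ p : RegularSuperlevel hreg₂, 1 / 4 ≤ g₂ (RegularSublevel.incl h₂ p) := fun p =>
    sub_nonpos.1 (RegularSublevel.apply_incl_le h₂ p)
  have hbd₁ : ∀ p : RegularSuperlevel hreg₁,
      p ∈ (𝓡∂ (k + 1)).boundary (RegularSuperlevel hreg₁) ↔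
        g₁ (RegularSublevel.incl h₁ p) = 1 / 4 := fun p => by
    rw [RegularSublevel.mem_boundary_iff]
    change (1 / 4 : ℝ) - g₁ (RegularSublevel.incl h₁ p) = 0 ↔ _
    rw [sub_eq_zero, eq_comm]
  have hbd₂ : ∀ p : RegularSuperlevel hreg₂,
      p ∈ (𝓡∂ (k + 1)).boundary (RegularSuperlevel hreg₂) ↔
        g₂ (RegularSublevel.incl h₂ p) = 1 / 4 := fun p => by
    rw [RegularSublevel.mem_boundary_iff]
    change (1 / 4 : ℝ) - g₂ (RegularSublevel.incl h₂ p) = 0 ↔ _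
    rw [sub_eq_zero, eq_comm]
  -- points of the superlevel sets lie in the open pieces
  have hinA₁ : ∀ p : RegularSuperlevel hreg₁, RegularSublevel.incl h₁ p ∈ A₁ := by
    intro p
    show RegularSublevel.incl h₁ p ∈ (range fun f : F => T₁ (f, 0))ᶜ
    rintro ⟨f, hf⟩
    have h := hsup₁ p
    rw [← hf] at h
    have : g₁ (T₁ (f, 0)) < 1 / 4 := (hlt₁ (f, 0)).2 (by norm_num)
    linarith
  have hinA₂ : ∀ p : RegularSuperlevel hreg₂, RegularSublevel.incl h₂ p ∈ A₂ := by
    intro p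
    show RegularSublevel.incl h₂ p ∈ (range fun f : F => T₂ (f, 0))ᶜ
    rintro ⟨f, hf⟩
    have h := hsup₂ p
    rw [← hf] at h
    have : g₂ (T₂ (f, 0)) < 1 / 4 := (hlt₂ (f, 0)).2 (by norm_num)
    linarith
  -- the level spheres: a boundary point is `Tᵢ q` with `‖q.2‖ = ½`
  have hlev₁ : ∀ z : (𝓡∂ (k + 1)).boundary (RegularSuperlevel hreg₁),
      ∃ q : F × EuclideanSpace ℝ (Fin c), ‖q.2‖ = 1 / 2 ∧ T₁ q = RegularSublevel.incl h₁ z.1 := by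
    intro z
    have hz : g₁ (RegularSublevel.incl h₁ z.1) = 1 / 4 := (hbd₁ z.1).1 z.2
    have hmem : RegularSublevel.incl h₁ z.1 ∈ g₁ ⁻¹' {1 / 4} := hz
    rw [level_eq_image_tube hle₁ hlt₁ hout₁] at hmem
    obtain ⟨q, ⟨-, hq⟩, hqz⟩ := hmem
    exact ⟨q, mem_sphere_zero_iff_norm.1 hq, hqz⟩
  have hlev₂ : ∀ z : (𝓡∂ (k + 1)).boundary (RegularSuperlevel hreg₂),
      ∃ q : F × EuclideanSpace ℝ (Fin c), ‖q.2‖ = 1 / 2 ∧ T₂ q = RegularSublevel.incl h₂ z.1 := by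
    intro z
    have hz : g₂ (RegularSublevel.incl h₂ z.1) = 1 / 4 := (hbd₂ z.1).1 z.2
    have hmem : RegularSublevel.incl h₂ z.1 ∈ g₂ ⁻¹' {1 / 4} := hz
    rw [level_eq_image_tube hle₂ hlt₂ hout₂] at hmem
    obtain ⟨q, ⟨-, hq⟩, hqz⟩ := hmem
    exact ⟨q, mem_sphere_zero_iff_norm.1 hq, hqz⟩
  -- the identification of the boundaries: `T₁ q ↦ T₂ q` on the level spheres
  have hval₂ : ∀ q : F × EuclideanSpace ℝ (Fin c), ‖q.2‖ = 1 / 2 → g₂ (T₂ q) = 1 / 4 := fun q hq =>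
    le_antisymm ((hle₂ q).2 hq.le) ((le_tubeFunction_apply_iff hlt₂ q).2 hq.ge)
  have hval₁ : ∀ q : F × EuclideanSpace ℝ (Fin c), ‖q.2‖ = 1 / 2 → g₁ (T₁ q) = 1 / 4 := fun q hq =>
    le_antisymm ((hle₁ q).2 hq.le) ((le_tubeFunction_apply_iff hlt₁ q).2 hq.ge)
  let ψf : (𝓡∂ (k + 1)).boundary (RegularSuperlevel hreg₁) →
      (𝓡∂ (k + 1)).boundary (RegularSuperlevel hreg₂) := fun z =>
    ⟨RegularSublevel.mk h₂ (T₂ (invFun T₁ (RegularSublevel.incl h₁ z.1))) (by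
        obtain ⟨q, hq, hqz⟩ := hlev₁ z
        rw [← hqz, leftInverse_invFun hi₁ q]
        exact sub_nonpos.2 (hval₂ q hq).ge), by
        rw [hbd₂]
        change g₂ (T₂ (invFun T₁ (RegularSublevel.incl h₁ z.1))) = 1 / 4
        obtain ⟨q, hq, hqz⟩ := hlev₁ z
        rw [← hqz, leftInverse_invFun hi₁ q]
        exact hval₂ q hq⟩
  let ψb : (𝓡∂ (k + 1)).boundary (RegularSuperlevel hreg₂) →
      (𝓡∂ (k + 1)).boundary (RegularSuperlevel hreg₁) := fun z =>
    ⟨RegularSublevel.mk h₁ (T₁ (invFun T₂ (RegularSublevel.incl h₂ z.1))) (by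
        obtain ⟨q, hq, hqz⟩ := hlev₂ z
        rw [← hqz, leftInverse_invFun hi₂ q]
        exact sub_nonpos.2 (hval₁ q hq).ge), by
        rw [hbd₁]
        change g₁ (T₁ (invFun T₂ (RegularSublevel.incl h₂ z.1))) = 1 / 4
        obtain ⟨q, hq, hqz⟩ := hlev₂ z
        rw [← hqz, leftInverse_invFun hi₂ q]
        exact hval₁ q hq⟩
  have hψf : ∀ z, RegularSublevel.incl h₂ (ψf z).1 =
      T₂ (invFun T₁ (RegularSublevel.incl h₁ z.1)) := fun z => rfl
  have hψb : ∀ z, RegularSublevel.incl h₁ (ψb z).1 =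
      T₁ (invFun T₂ (RegularSublevel.incl h₂ z.1)) := fun z => rfl
  have hψf_apply : ∀ z (q : F × EuclideanSpace ℝ (Fin c)), RegularSublevel.incl h₁ z.1 = T₁ q →
      RegularSublevel.incl h₂ (ψf z).1 = T₂ q := by
    intro z q hzq
    rw [hψf, hzq, leftInverse_invFun hi₁ q]
  have hψb_apply : ∀ z (q : F × EuclideanSpace ℝ (Fin c)), RegularSublevel.incl h₂ z.1 = T₂ q →
      RegularSublevel.incl h₁ (ψb z).1 = T₁ q := by
    intro z q hzq
    rw [hψb, hzq, leftInverse_invFun hi₂ q]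
  let ψ : (RegularSublevel.boundaryData h₁).carrier ≃ (RegularSublevel.boundaryData h₂).carrier :=
  { toFun := ψf
    invFun := ψb
    left_inv := fun z => by
      obtain ⟨q, -, hqz⟩ := hlev₁ z
      apply Subtype.ext
      apply RegularSublevel.injective_incl h₁
      rw [hψb_apply (ψf z) q (hψf_apply z q hqz.symm), hqz]
    right_inv := fun z => by
      obtain ⟨q, -, hqz⟩ := hlev₂ z
      apply Subtype.ext
      apply RegularSublevel.injective_incl h₂
      rw [hψf_apply (ψb z) q (hψb_apply z q hqz.symm), hqz] }
  -- the two embeddings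
  let i₁ : RegularSuperlevel hreg₁ → A₁ := fun p => ⟨RegularSublevel.incl h₁ p, hinA₁ p⟩
  let i₂ : RegularSuperlevel hreg₂ → A₂ := fun p => ⟨RegularSublevel.incl h₂ p, hinA₂ p⟩
  have hi₁e : Manifold.IsSmoothEmbedding (𝓡∂ (k + 1)) (𝓡 (k + 1)) ∞ i₁ :=
    (RegularSublevel.isSmoothEmbedding_incl h₁).opensCodRestrict A₁ hinA₁
  have hi₂e : Manifold.IsSmoothEmbedding (𝓡∂ (k + 1)) (𝓡 (k + 1)) ∞ i₂ :=
    (RegularSublevel.isSmoothEmbedding_incl h₂).opensCodRestrict A₂ hinA₂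
  let G : BoundaryGluingData (RegularSublevel.boundaryData h₁) (RegularSublevel.boundaryData h₂)
      ψ D.Glued :=
  { jA := D.inl ∘ i₁
    jB := D.inr ∘ i₂
    isSmoothEmbedding_jA := D.isSmoothEmbedding_inl_comp hi₁e
    isSmoothEmbedding_jB := D.isSmoothEmbedding_inr_comp hi₂e
    range_union := by
      apply eq_univ_of_forall
      intro x
      obtain (⟨a, rfl⟩ | ⟨b, rfl⟩) := D.exists_inl_or_inr x
      · by_cases ha : 1 / 4 ≤ g₁ (a : Y₁)
        · refine Or.inl ⟨RegularSublevel.mk h₁ (a : Y₁) (sub_nonpos.2 ha), ?_⟩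
          exact congrArg D.inl (Subtype.ext rfl)
        · -- `a = T₁ q` with `0 < ‖q.2‖ < ½` is glued to `T₂ (q.1, ρ q.2)`, `‖ρ q.2‖ > ½`
          rw [not_le] at ha
          obtain ⟨q, hqa⟩ := mem_range_of_tubeFunction_lt hout₁ (ha.trans (by norm_num))
          have hq : ‖q.2‖ < 1 / 2 := (hlt₁ q).1 (hqa ▸ ha)
          have hq0 : q.2 ≠ 0 := (hmemA₁ q).1 (hqa ▸ a.2)
          have hq1 : ‖q.2‖ < 1 := hq.trans (by norm_num)
          have hsrc : a ∈ D.glue.source := by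
            rw [hsrc]; exact ⟨q, ⟨hq0, hq1⟩, hqa⟩
          have hgl : (D.glue a : Y₂) = T₂ (q.1, (((1 - ‖q.2‖) * ‖q.2‖⁻¹) • q.2)) :=
            hglue a q hq0 hq1 hqa.symm
          have hge : 1 / 4 ≤ g₂ (D.glue a : Y₂) := by
            rw [hgl, le_tubeFunction_apply_iff hlt₂]
            dsimp only
            rw [norm_radialFlip hq0 hq1.le]
            linarith
          refine Or.inr ⟨RegularSublevel.mk h₂ (D.glue a : Y₂) (sub_nonpos.2 hge), ?_⟩
          show D.inr (i₂ _) = D.inl a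
          rw [← D.inr_glue hsrc]
          exact congrArg D.inr (Subtype.ext rfl)
      · by_cases hb : 1 / 4 ≤ g₂ (b : Y₂)
        · refine Or.inr ⟨RegularSublevel.mk h₂ (b : Y₂) (sub_nonpos.2 hb), ?_⟩
          exact congrArg D.inr (Subtype.ext rfl)
        · rw [not_le] at hb
          obtain ⟨q, hqb⟩ := mem_range_of_tubeFunction_lt hout₂ (hb.trans (by norm_num))
          have hq : ‖q.2‖ < 1 / 2 := (hlt₂ q).1 (hqb ▸ hb)
          have hq0 : q.2 ≠ 0 := (hmemA₂ q).1 (hqb ▸ b.2)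
          have hq1 : ‖q.2‖ < 1 := hq.trans (by norm_num)
          have htg : b ∈ D.glue.target := by
            rw [htgt]; exact ⟨q, ⟨hq0, hq1⟩, hqb⟩
          have hsrc' : D.glue.symm b ∈ D.glue.source := D.glue.map_target htg
          have hgl : (D.glue.symm b : Y₁) ∈
              T₁ '' {q : F × EuclideanSpace ℝ (Fin c) | q.2 ≠ 0 ∧ ‖q.2‖ < 1} := by
            have := hsrc'; rwa [hsrc] at this
          obtain ⟨q', hq', hq'b⟩ := hgl
          have hback : (D.glue (D.glue.symm b) : Y₂) = b := by rw [D.glue.right_inv htg]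
          have hge : 1 / 4 ≤ g₁ (D.glue.symm b : Y₁) := by
            -- `glue (T₁ q') = T₂ (q'.1, ρ q'.2) = b = T₂ q`, so `‖q.2‖ = 1 - ‖q'.2‖ < ½`
            have h1 : (D.glue (D.glue.symm b) : Y₂) =
                T₂ (q'.1, (((1 - ‖q'.2‖) * ‖q'.2‖⁻¹) • q'.2)) :=
              hglue _ q' hq'.1 hq'.2 hq'b.symm
            rw [hback, ← hqb] at h1
            have h2 := congrArg (fun p : F × EuclideanSpace ℝ (Fin c) => ‖p.2‖) (hi₂ h1)
            dsimp only at h2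
            rw [norm_radialFlip hq'.1 hq'.2.le] at h2
            rw [← hq'b, le_tubeFunction_apply_iff hlt₁]
            linarith
          refine Or.inl ⟨RegularSublevel.mk h₁ (D.glue.symm b : Y₁) (sub_nonpos.2 hge), ?_⟩
          show D.inl (i₁ _) = D.inr b
          rw [← D.inl_glue_symm htg]
          exact congrArg D.inl (Subtype.ext rfl)
    jA_eq_jB_iff := by
      intro p p'
      constructor
      · intro hpp'
        have h := D.inl_eq_inr_iff.1 hpp'
        obtain ⟨hsrc', hgl⟩ := h
        have hmem : (RegularSublevel.incl h₁ p) ∈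
            T₁ '' {q : F × EuclideanSpace ℝ (Fin c) | q.2 ≠ 0 ∧ ‖q.2‖ < 1} := by
          have := hsrc'; rwa [hsrc] at this
        obtain ⟨q, hq, hqp⟩ := hmem
        have hgl' : (D.glue (i₁ p) : Y₂) = T₂ (q.1, (((1 - ‖q.2‖) * ‖q.2‖⁻¹) • q.2)) :=
          hglue _ q hq.1 hq.2 hqp.symm
        have hp' : RegularSublevel.incl h₂ p' = T₂ (q.1, (((1 - ‖q.2‖) * ‖q.2‖⁻¹) • q.2)) := by
          rw [← hgl']
          exact (congrArg Subtype.val hgl).symm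
        -- `‖q.2‖ = ½`: `≥` from `p ∈ {¼ ≤ g₁}`, `≤` from `p' ∈ {¼ ≤ g₂}`
        have hge : 1 / 2 ≤ ‖q.2‖ := (le_tubeFunction_apply_iff hlt₁ q).1 (hqp ▸ hsup₁ p)
        have hle : ‖q.2‖ ≤ 1 / 2 := by
          have := (le_tubeFunction_apply_iff hlt₂ _).1 (hp' ▸ hsup₂ p')
          dsimp only at this
          rw [norm_radialFlip hq.1 hq.2.le] at this
          linarith
        have hq2 : ‖q.2‖ = 1 / 2 := le_antisymm hle hge
        have hpb : p ∈ (𝓡∂ (k + 1)).boundary (RegularSuperlevel hreg₁) := by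
          rw [hbd₁, ← hqp]; exact hval₁ q hq2
        refine ⟨⟨p, hpb⟩, rfl, ?_⟩
        apply RegularSublevel.injective_incl h₂
        show RegularSublevel.incl h₂ p' = RegularSublevel.incl h₂ (ψf ⟨p, hpb⟩).1
        rw [hψf_apply ⟨p, hpb⟩ q hqp.symm, hp']
        congr 1
        exact Prod.ext rfl (radialFlip_of_norm_eq_half hq2)
      · rintro ⟨z, rfl, rfl⟩
        obtain ⟨q, hq, hqz⟩ := hlev₁ z
        have hq0 : q.2 ≠ 0 := by
          rw [← norm_ne_zero_iff, hq]; norm_num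
        have hq1 : ‖q.2‖ < 1 := by rw [hq]; norm_num
        have hsrc' : i₁ z.1 ∈ D.glue.source := by
          rw [hsrc]; exact ⟨q, ⟨hq0, hq1⟩, hqz⟩
        show D.inl (i₁ z.1) = D.inr (i₂ (ψf z).1)
        rw [← D.inr_glue hsrc']
        congr 1
        apply Subtype.ext
        show (D.glue (i₁ z.1) : Y₂) = RegularSublevel.incl h₂ (ψf z).1
        rw [hglue _ q hq0 hq1 hqz.symm, hψf_apply z q hqz.symm]
        congr 1
        exact Prod.ext rfl (radialFlip_of_norm_eq_half hq) }
  exact ⟨D.Glued, inferInstance, hT2, hsc, hcpt, inferInstance, inferInstance, ψ, G,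
    fun z q hzq => hψf_apply z q hzq⟩

/-! ### §5 The fibre sum from the two tubes alone -/

/-- **Fibre sums exist (smooth category, tube coordinates).**  For smooth open embeddings
`T₁ : F × ℝᶜ → Y₁`, `T₂ : F × ℝᶜ → Y₂` (`F` compact, `Yᵢ` closed, `c ≥ 1`) there are tube
functions `g₁`, `g₂` (`exists_tube_function`), a closed smooth manifold `X = Y₁ #_F Y₂`, a
bijection `ψ` of the boundaries of the two tube complements `{¼ ≤ gᵢ} = Yᵢ ∖ Tᵢ(F × B(0, ½))`
with `ψ(T₁(f, v)) = T₂(f, v)`, and `G : BoundaryGluingData _ _ ψ X` (see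
`exists_fibreSum_boundaryGluingData`).  Gompf 1995, §1; Gompf–Stipsicz 1999, §7.1.
[cite: Gompf1995, §1] -/
theorem exists_fibreSum (hc : 0 < c)
    (hT₁ : Manifold.IsSmoothEmbedding ((𝓡 d).prod (𝓡 c)) (𝓡 (k + 1)) ∞ T₁)
    (hT₁o : IsOpen (range T₁))
    (hT₂ : Manifold.IsSmoothEmbedding ((𝓡 d).prod (𝓡 c)) (𝓡 (k + 1)) ∞ T₂)
    (hT₂o : IsOpen (range T₂)) :
    ∃ (g₁ : Y₁ → ℝ) (hreg₁ : IsRegularLevel (𝓡 (k + 1)) g₁ (1 / 4)) (g₂ : Y₂ → ℝ)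
      (hreg₂ : IsRegularLevel (𝓡 (k + 1)) g₂ (1 / 4)),
      (∀ x, g₁ (T₁ x) ≤ 1 / 4 ↔ ‖x.2‖ ≤ 1 / 2) ∧ (∀ x, g₁ (T₁ x) < 1 / 4 ↔ ‖x.2‖ < 1 / 2) ∧
      (∀ y, y ∉ range T₁ → g₁ y = 1) ∧
      (∀ x, g₂ (T₂ x) ≤ 1 / 4 ↔ ‖x.2‖ ≤ 1 / 2) ∧ (∀ x, g₂ (T₂ x) < 1 / 4 ↔ ‖x.2‖ < 1 / 2) ∧
      (∀ y, y ∉ range T₂ → g₂ y = 1) ∧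
      ∃ (X : Type) (_ : TopologicalSpace X) (_ : T2Space X) (_ : SecondCountableTopology X)
        (_ : CompactSpace X) (_ : ChartedSpace (EuclideanSpace ℝ (Fin (k + 1))) X)
        (_ : IsManifold (𝓡 (k + 1)) ∞ X)
        (ψ : (RegularSublevel.boundaryData hreg₁.const_sub).carrier ≃
          (RegularSublevel.boundaryData hreg₂.const_sub).carrier)
        (_ : BoundaryGluingData (RegularSublevel.boundaryData hreg₁.const_sub)
          (RegularSublevel.boundaryData hreg₂.const_sub) ψ X),
        ∀ (z : (RegularSublevel.boundaryData hreg₁.const_sub).carrier)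
          (q : F × EuclideanSpace ℝ (Fin c)),
          RegularSublevel.incl hreg₁.const_sub z.1 = T₁ q →
            RegularSublevel.incl hreg₂.const_sub (ψ z).1 = T₂ q := by
  obtain ⟨g₁, hreg₁, hle₁, hlt₁, hout₁⟩ := exists_tube_function hT₁ hT₁o
  obtain ⟨g₂, hreg₂, hle₂, hlt₂, hout₂⟩ := exists_tube_function hT₂ hT₂o
  exact ⟨g₁, hreg₁, g₂, hreg₂, hle₁, hlt₁, hout₁, hle₂, hlt₂, hout₂,
    exists_fibreSum_boundaryGluingData hc hT₁ hT₁o hT₂ hT₂o hreg₁ hle₁ hlt₁ hout₁ hreg₂ hle₂ hlt₂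
      hout₂⟩

end FibreSum

end Literature.Topology.FourManifolds
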